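import Summits.ResolutionOfSingularities.ResolutionOfSingularities.Theorems.PurelyInseparableDim4E2OfCJSRows
import Literature.AlgebraicGeometry.Hironaka2017.Lib.SpecOrders
import Literature.AlgebraicGeometry.Resolution.OriginLocalRing
import Mathlib.RingTheory.KrullDimension.Regular
import HarnessLib

/-!
# F4-I(3,3) from CJS — row (X) `SettingRow` DISCHARGED: the local ring of `z³ + F = 0` at the origin is
# excellent, `4`-dimensional, of residue characteristic `3` (so (F1) holds), and its closed point is a
# permissible centre (cell `res-dim4-pi`, WORD #52 (c), sub-row (X) of the E2 transfer row)

[OURS · counted 0 · AI work weaker than expert review.]  Cell `res-dim4-pi` (D-0157 DOOR 2), seat `res-dim4-p-2`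
g2; K → res-dim4-p-9 g2.  NOTHING here proves `NoIsolatedTrap 3 3` or resolution of singularities in dimension
≥ 4 / characteristic `p`; this file closes ONE of the five sub-rows of `…E2OfCJSRows` (p663940), the cheapest.

## What is proved (sorry-free, no named facts)

The ring `HypStalk L F = 𝒪_{𝔸⁵_L,0} ⧸ (z³ + F)_0` of `…E2OfCJSRows`, for `F` of residual order `3`:

* §1 the origin stalk `R₀ = 𝒪_{𝔸⁵_L, 0}` IS the localisation of `L[x₀,…,x₄]` at the origin (Mathlib's
  structure-sheaf instance, through the HIRONAKA-L plumbing `SpecOrders.St`), hence isomorphic to the tree's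
  `OriginLocalization L 5` — a regular local DOMAIN of Krull dimension `5` (`ringKrullDim_originStalk`);
* §2 the germ `g₀` of `z³ + F`: `stalkIdeal (hypSheaf 3 F) 0 = (g₀)` (`SpecOrders.stalkIdeal_shf`), `g₀ ≠ 0`
  (`z³` survives), `g₀ ∈ 𝔪` iff `F(0) = 0`;
* §3 the quotient `R₀ ⧸ (g₀)`: Krull dimension EXACTLY `4` (Mathlib
  `ringKrullDim_quotient_span_singleton_succ_eq_ringKrullDim_of_mem_nonZeroDivisors`), EXCELLENT (field →
  finite-type algebra → localisation → quotient, the tree's PROVED `ExcellentRings*` chain — Grothendieck's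
  G-ring theorem is a theorem of the tree), of characteristic `3`;
* §4 **`settingRow : E2OfCJS.SettingRow`** — for every local scheme `(S, s)` PRESENTED by such an `F` over a
  perfect field of characteristic `3`: `S` excellent (`LocalChains.isExcellent_of_isLocalAt`),
  `dim S = 4 ≤ 5` (`LocalChains.topologicalKrullDim_eq_of_isLocalAt`), `CharHypothesis S s` (d = 4,
  `4 + 2 ≤ 2·3`), and the point centre `{s}` permissible (`isPermissible_vanishingIdeal_singleton_iff`: the
  maximal ideal of a `4`-dimensional local ring is not a minimal prime).

After this file the E2 transfer row reads «F4-I(3,3) ⟸ CJS Thm 6.40 ∧ M ∧ N ∧ E ∧ I» (X closed ‖ K).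
bears_on: LADDER-RESOLUTION:D157-DOOR2 (res-dim4-pi · F4-I(3,3) · CJS dictionary · row X).  Supports
stmt-ResolutionOfSingularities-16155 (helper).
-/

set_option linter.dupNamespace false -- mandated namespace of this single-conjunct summit

noncomputable section

open CategoryTheory AlgebraicGeometry TopologicalSpace IsLocalRing
open Literature.AlgebraicGeometry.Resolution
open Literature.AlgebraicGeometry.Resolution.Hauser2010
open Literature.AlgebraicGeometry.Resolution.AffinePointBlowup (P A γ ξ)
open Literature.AlgebraicGeometry.Hironaka2017.SpecOrders
open Literature.AlgebraicGeometry.CossartJannsenSaito2020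
open Scheme.IdealSheafData

namespace Summit.ResolutionOfSingularities.ResolutionOfSingularities.Theorems.PIDim4

namespace E2OfCJS

open SigmaMaxModificationsCorridor3.Moving.LocalChains (topologicalKrullDim_eq_of_isLocalAt isExcellent_of_isLocalAt)

variable (L : Type) [Field L]

/-! ## §1 The origin stalk of `𝔸⁵_L` is the localisation of `L[x₀,…,x₄]` at the origin -/

/-- The stalk `R₀ = 𝒪_{𝔸⁵_L, 0}` (HIRONAKA-L plumbing `SpecOrders.St`, definitionally
`(P 4 L).presheaf.stalk (ξ 4 L)`). [folklore] -/
abbrev originStalk : Type := St (A 4 L) (ξ 4 L)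

/-- The origin's prime is the tree's `originIdeal L 5 = ker (f ↦ f(0))`. [folklore] -/
theorem ξ_asIdeal_eq : (ξ 4 L).asIdeal = Literature.AlgebraicGeometry.Resolution.originIdeal L 5 := rfl

/-- `𝒪_{𝔸⁵_L,0} ≅ L[x]_{(x)}` as `L[x]`-algebras: two localisations at the same prime. [folklore] -/
def originStalkEquiv : Localization.AtPrime (ξ 4 L).asIdeal ≃ₐ[A 4 L] originStalk L :=
  IsLocalization.algEquiv (ξ 4 L).asIdeal.primeCompl _ _

/-- `𝒪_{𝔸⁵_L,0}` is a domain (a localisation of the domain `L[x₀,…,x₄]`; a theorem, not an instance —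
no global instance on the tree's stalk type). [folklore] -/
theorem isDomain_originStalk : IsDomain (originStalk L) :=
  IsLocalization.isDomain_of_le_nonZeroDivisors (M := (ξ 4 L).asIdeal.primeCompl) _
    (Ideal.primeCompl_le_nonZeroDivisors _)

/-- **`dim 𝒪_{𝔸⁵_L,0} = 5`** (the tree's `ringKrullDim_originLocalization`: `L[x]_{(x)}` is regular local of
dimension `5`). [folklore] -/
theorem ringKrullDim_originStalk : ringKrullDim (originStalk L) = 5 := by
  rw [← ringKrullDim_eq_of_ringEquiv (originStalkEquiv L).toRingEquiv]
  exact ringKrullDim_originLocalization L 5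

/-! ## §2 The germ of `z³ + F` at the origin -/

/-- `(z³ + F)(0) = F(0)` (`p = 3 ≠ 0`). [folklore] -/
theorem constantCoeff_hyp_three (F : MvPolynomial (Fin 4) L) :
    MvPolynomial.constantCoeff (hyp 3 F) = MvPolynomial.constantCoeff F := by
  unfold hyp
  rw [map_add, map_pow, MvPolynomial.constantCoeff_X, zero_pow (by norm_num), zero_add,
    MvPolynomial.constantCoeff_rename]

/-- `z³ + F ≠ 0`: the monomial `z³` survives (`F` does not involve `z`). [folklore] -/
theorem hyp_three_ne_zero (F : MvPolynomial (Fin 4) L) : hyp 3 F ≠ 0 := by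
  intro h
  have hc := congrArg (MvPolynomial.coeff (Finsupp.single 0 3)) h
  have h0 : MvPolynomial.coeff (Finsupp.single (0 : Fin (4 + 1)) 3) (MvPolynomial.rename Fin.succ F) = 0 := by
    apply MvPolynomial.coeff_rename_eq_zero
    intro u hu
    exfalso
    have := DFunLike.congr_fun hu 0
    rw [Finsupp.mapDomain_notin_range, Finsupp.single_eq_same] at this
    · exact absurd this (by norm_num)
    · rintro ⟨i, hi⟩; exact Fin.succ_ne_zero i hi
  unfold hyp at hc
  rw [MvPolynomial.coeff_add, MvPolynomial.coeff_X_pow, if_pos rfl, h0, add_zero, MvPolynomial.coeff_zero] at hc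
  exact one_ne_zero hc

/-- **The germ `g₀` of `z³ + F` in `𝒪_{𝔸⁵_L,0}`.** [folklore] -/
abbrev hypGerm (F : MvPolynomial (Fin 4) L) : originStalk L := algebraMap (A 4 L) (originStalk L) (hyp 3 F)

/-- **`(z³ + F)_0 = (g₀)`**: the stalk of the tree's ideal sheaf `hypSheaf 3 F` at the origin is principal,
generated by the germ (HIRONAKA-L `SpecOrders.stalkIdeal_shf`). [folklore] -/
theorem stalkIdeal_hypSheaf_ξ (F : MvPolynomial (Fin 4) L) :
    stalkIdeal (hypSheaf 3 F) (ξ 4 L) = Ideal.span {hypGerm L F} := by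
  have h : hypSheaf 3 F = shf (A 4 L) (Ideal.span {hyp 3 F}) := by
    unfold hypSheaf shf; rw [Ideal.map_span, Set.image_singleton]; rfl
  rw [h, stalkIdeal_shf, Ideal.map_span, Set.image_singleton]

/-- `g₀ ∈ 𝔪_{𝔸⁵,0}` when `F(0) = 0`. [folklore] -/
theorem hypGerm_mem_maximalIdeal (F : MvPolynomial (Fin 4) L) (hF : MvPolynomial.constantCoeff F = 0) :
    hypGerm L F ∈ maximalIdeal (originStalk L) := by
  have h1 : hyp 3 F ∈ (ξ 4 L).asIdeal := by
    show hyp 3 F ∈ Literature.AlgebraicGeometry.Resolution.originIdeal L 5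
    rw [Literature.AlgebraicGeometry.Resolution.mem_originIdeal_iff, constantCoeff_hyp_three]; exact hF
  exact (IsLocalization.AtPrime.to_map_mem_maximal_iff (originStalk L) (ξ 4 L).asIdeal (hyp 3 F)).mpr h1

/-- `g₀ ≠ 0` (the localisation map of a domain at a prime is injective). [folklore] -/
theorem hypGerm_ne_zero (F : MvPolynomial (Fin 4) L) : hypGerm L F ≠ 0 := by
  intro h
  have hinj := IsLocalization.injective (originStalk L) (Ideal.primeCompl_le_nonZeroDivisors (ξ 4 L).asIdeal)
  exact hyp_three_ne_zero L F (hinj (by rw [map_zero]; exact h))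

/-- `g₀` is a non-zero-divisor. [folklore] -/
theorem hypGerm_mem_nonZeroDivisors (F : MvPolynomial (Fin 4) L) :
    hypGerm L F ∈ nonZeroDivisors (originStalk L) := by
  haveI := isDomain_originStalk L
  exact mem_nonZeroDivisors_of_ne_zero (hypGerm_ne_zero L F)

/-! ## §3 The hypersurface local ring `𝒪_{𝔸⁵,0} ⧸ (g₀)`: dimension `4`, excellent, characteristic `3` -/

/-- **`dim 𝒪_{𝔸⁵_L,0} ⧸ (z³ + F) = 4`** when `F(0) = 0`: a non-zero-divisor in the maximal ideal of a
Noetherian local ring drops the dimension by exactly one (Mathlib, Stacks 00KW). [folklore] -/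
theorem ringKrullDim_originStalk_quot (F : MvPolynomial (Fin 4) L) (hF : MvPolynomial.constantCoeff F = 0) :
    ringKrullDim (originStalk L ⧸ Ideal.span {hypGerm L F}) = 4 := by
  have h := ringKrullDim_quotient_span_singleton_succ_eq_ringKrullDim_of_mem_nonZeroDivisors
    (hypGerm_mem_nonZeroDivisors L F) (hypGerm_mem_maximalIdeal L F hF)
  rw [ringKrullDim_originStalk] at h
  generalize hd : ringKrullDim (originStalk L ⧸ Ideal.span {hypGerm L F}) = d at h
  cases d with
  | bot => exact absurd h (by decide)
  | coe a =>
    cases a with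
    | top => exact absurd h (by decide)
    | coe n =>
      have h1 : (((n + 1 : ℕ) : ℕ∞) : WithBot ℕ∞) = (((5 : ℕ) : ℕ∞) : WithBot ℕ∞) := by
        push_cast; exact h
      have h2 : ((n + 1 : ℕ) : ℕ∞) = ((5 : ℕ) : ℕ∞) := WithBot.coe_injective h1
      have h3 : n + 1 = 5 := by exact_mod_cast h2
      have hn : n = 4 := by omega
      subst hn; rfl

/-- **`𝒪_{𝔸⁵_L,0} ⧸ (z³ + F)` is EXCELLENT**: `L` is excellent (a field), hence `L[x₀,…,x₄]` (finite type),
hence `𝒪_{𝔸⁵,0}` (a localisation), hence the quotient — every step a PROVED theorem of the tree's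
`ExcellentRings*` files (Matsumura §32 p. 260; Grothendieck's G-ring theorem `Stacks07PV_holds`).
[cite: Matsumura1987, §32 p. 260] -/
theorem isExcellentRing_originStalk_quot (F : MvPolynomial (Fin 4) L) :
    IsExcellentRing (originStalk L ⧸ Ideal.span {hypGerm L F}) := by
  have hA : IsExcellentRing (A 4 L) := (isExcellentRing_of_field L).of_finiteType'
  have hR : IsExcellentRing (originStalk L) := IsExcellentRing.of_isLocalization (ξ 4 L).asIdeal.primeCompl hA
  exact IsExcellentRing.of_surjective (Ideal.Quotient.mk _) Ideal.Quotient.mk_surjective hR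

/-- The quotient is non-trivial when `F(0) = 0` (`g₀ ∈ 𝔪` is not a unit). [folklore] -/
theorem nontrivial_originStalk_quot (F : MvPolynomial (Fin 4) L) (hF : MvPolynomial.constantCoeff F = 0) :
    Nontrivial (originStalk L ⧸ Ideal.span {hypGerm L F}) :=
  Ideal.Quotient.nontrivial_iff.mpr fun h =>
    (IsLocalRing.mem_maximalIdeal _ |>.mp (hypGerm_mem_maximalIdeal L F hF)) (Ideal.span_singleton_eq_top.mp h)

/-- **`𝒪_{𝔸⁵_L,0} ⧸ (z³ + F)` has characteristic `3`** when `L` has: it receives a ring map from the field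
`L` (injective, the target being non-trivial). [folklore] -/
theorem charP_originStalk_quot [CharP L 3] (F : MvPolynomial (Fin 4) L)
    (hF : MvPolynomial.constantCoeff F = 0) : CharP (originStalk L ⧸ Ideal.span {hypGerm L F}) 3 := by
  haveI := nontrivial_originStalk_quot L F hF
  exact charP_of_injective_ringHom
    (((Ideal.Quotient.mk (Ideal.span {hypGerm L F})).comp
      ((algebraMap (A 4 L) (originStalk L)).comp (MvPolynomial.C : L →+* A 4 L))).injective) 3

/-! ## §4 Row (X): the setting of a presented local scheme -/

/-- **`HypStalk L F ≅ 𝒪_{𝔸⁵_L,0} ⧸ (g₀)`** as rings (the stalk ideal is `(g₀)`). [folklore] -/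
def hypStalkEquivQuot (F : MvPolynomial (Fin 4) L) :
    HypStalk L F ≃+* originStalk L ⧸ Ideal.span {hypGerm L F} :=
  Ideal.quotEquivOfEq (stalkIdeal_hypSheaf_ξ L F)

variable {L}

/-- A presentation `𝒪_{S,s} ≅ HypStalk L F` read as a ring isomorphism onto `𝒪_{𝔸⁵,0} ⧸ (g₀)`. [folklore] -/
theorem PresentedBy.nonempty_ringEquiv {F : MvPolynomial (Fin 4) L} {S : Scheme.{0}} {s : S}
    (h : PresentedBy L F S s) : Nonempty (S.presheaf.stalk s ≃+* originStalk L ⧸ Ideal.span {hypGerm L F}) := by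
  obtain ⟨e⟩ := h
  exact ⟨e.commRingCatIsoToRingEquiv.trans (hypStalkEquivQuot L F)⟩

/-- Residual order `3` makes `F` vanish at the origin. [folklore] -/
theorem constantCoeff_eq_zero_of_ordZero_eq_three {F : MvPolynomial (Fin 4) L} (hF : ordZero F = (3 : ℕ∞)) :
    MvPolynomial.constantCoeff F = 0 := by
  rw [← one_le_ordZero_iff, hF]
  exact_mod_cast (by norm_num : (1 : ℕ) ≤ 3)

/-- **The local ring of a presented point has dimension `4`, is excellent, and has characteristic `3`.**
[folklore] -/
theorem presented_stalk_facts [CharP L 3] {F : MvPolynomial (Fin 4) L} (hF : ordZero F = (3 : ℕ∞))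
    {S : Scheme.{0}} [IsLocallyNoetherian S] {s : S} (h : PresentedBy L F S s) :
    ringKrullDim (S.presheaf.stalk s) = 4 ∧ IsExcellentRing (S.presheaf.stalk s) ∧ CharP (S.presheaf.stalk s) 3 := by
  have hF0 := constantCoeff_eq_zero_of_ordZero_eq_three hF
  obtain ⟨e⟩ := h.nonempty_ringEquiv
  refine ⟨?_, ?_, ?_⟩
  · rw [ringKrullDim_eq_of_ringEquiv e]; exact ringKrullDim_originStalk_quot L F hF0
  · exact IsExcellentRing.of_ringEquiv e.symm (isExcellentRing_originStalk_quot L F)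
  · haveI := charP_originStalk_quot L F hF0
    exact charP_of_injective_ringHom (f := e.symm.toRingHom) e.symm.injective 3

/-- **ROW (X) `SettingRow` DISCHARGED.** For every local scheme `(S, s)` presented by `F` (`ordZero F = 3`)
over a perfect field of characteristic `3`: `S` is excellent, `dim S = 4 ≤ 5`, (F1) holds at `s`
(`4 + 2 ≤ 2·3`), and the point centre `{s}` is permissible (the maximal ideal of the `4`-dimensional local
ring `𝒪_{S,s}` is not a minimal prime). [OURS · row X of the E2 transfer row] [folklore] -/
theorem settingRow : SettingRow := by
  intro L _ _ _ F hF S _ s hloc hpres hcl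
  obtain ⟨hdim, hexc, hchar⟩ := presented_stalk_facts hF hpres
  have hdimS : topologicalKrullDim ↥S = (4 : WithBot ℕ∞) := by
    rw [topologicalKrullDim_eq_of_isLocalAt hloc, hdim]
  refine ⟨isExcellent_of_isLocalAt hloc hexc, ?_, ?_, ?_⟩
  · rw [hdimS]; exact_mod_cast (by norm_num : (4 : ℕ) ≤ 5)
  · -- (F1): `d = 4`, residue characteristic `3`
    have h3 : ringChar (ResidueField (S.presheaf.stalk s)) = 3 := by
      haveI := hchar
      apply CharP.ringChar_of_prime_eq_zero Nat.prime_three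
      have h0 : ((3 : ℕ) : S.presheaf.stalk s) = 0 := CharP.cast_eq_zero _ 3
      have := congrArg (IsLocalRing.residue (S.presheaf.stalk s)) h0
      rwa [map_natCast, map_zero] at this
    exact charHypothesis_of_dim_four_char_three s hdimS h3
  · -- the point centre is permissible: `𝔪` is not a minimal prime of a `4`-dimensional local ring
    rw [isPermissible_vanishingIdeal_singleton_iff hcl]
    intro hmin
    have h0 : (maximalIdeal (S.presheaf.stalk s)).height = 0 := Ideal.height_eq_zero_iff.mpr hmin
    have h := IsLocalRing.maximalIdeal_height_eq_ringKrullDim (R := S.presheaf.stalk s)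
    rw [h0, hdim] at h
    exact absurd h (by decide)

end E2OfCJS

end Summit.ResolutionOfSingularities.ResolutionOfSingularities.Theorems.PIDim4

end
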